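import Literature.NumberTheory.Automorphic.AutomorphicRepOfForm
import Literature.NumberTheory.Automorphic.HarishChandraFinitenessGLCuspidal
import Literature.NumberTheory.Automorphic.AutomorphicRepsGLCuspidalL2Step1ZFinite
import Literature.NumberTheory.Automorphic.AutomorphicRepsGLCuspidalL2Step4
import Literature.NumberTheory.Automorphic.PairLFunctionPolesRepDataRealisation
import Literature.NumberTheory.Automorphic.AutomorphicLFunctionFlathProofs
import Literature.NumberTheory.Automorphic.AutomorphicRepsGLSatakeProofs
import Literature.NumberTheory.Automorphic.UnramifiedHeckeScalarsProofs
import Literature.NumberTheory.Automorphic.UnramifiedHeckeLevel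
import HarnessLib

/-!
# A cuspidal Borel–Jacquet datum with the Satake parameters of a cuspidal `Π ⊂ L²_cusp(GL_n)`
# (Borel–Jacquet 1979, 4.6, in the weak form needed to realise `L²` liftings by data) — proofs

Topic `NumberTheory/Automorphic`; namespace `Literature.NumberTheory.Automorphic`. A proof file
(theorems only: no definition, no named fact, no instance).

The lifting theorems of the tree that are proved in the `L²` model (`CuspidalAutomorphicRepGL n K μ`:
irreducible closed invariant subspaces `Π` of `L²_cusp(GL_n(𝔸_K) ⧸ A_G GL_n(K), μ)`, with Satake
parameters `HasSatakeParameterAt` read on `K(𝔫)`-fixed `L²`-vectors) are transported to the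
Borel–Jacquet model (`CuspidalAutomorphicRepData n K hcpt`: an irreducible subquotient `W / W'` of
the `(𝔤, K_∞) × GL_n(𝔸_K^∞)`-module of cusp forms, with Satake parameters `HasSatakeParamAt` read on
`K(𝔫)`-invariant Hecke eigenforms modulo `W'`) through the two named facts of `AutomorphicRepsGL`
rendering Borel–Jacquet 1979, 4.6: `AutomorphicRepsGL.exists_cuspidalRepData_of_L2` (the space
`V_Π` of smooth `K_∞`-finite `Z(𝔤)`-finite vectors of `Π` is an *irreducible* module of cusp forms —
Harish-Chandra) and `hasSatakeParamAt_iff_L2` (the two notions of Satake parameter agree along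
`W = W' ⊕ V_Π`). For the typical consumer — "there is a cuspidal `π` on `GL_n(𝔸_K)` with
`t_{π,v} = t_{Π,v}` for almost every `v`" — much less is needed, and this file PROVES it outright,
combining three theorems of the tree: `V_Π ≠ 0` (`AutomorphicRepsGL.formsOfL2_ne_bot_holds`,
Borel–Jacquet 4.6, Step 1: `…CuspidalL2Step1ZFinite`), the automorphic representation GENERATED by
a non-zero form in a stable space (`IsStableSubmodule.exists_automorphicRepData_hasSatakeParamAt_of_eigenvector`,
`AutomorphicRepOfForm`: the stable closure of `φ` modulo a maximal stable subspace missing `φ` —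
Langlands 1979, proof of Prop. 2; no irreducibility theorem of Harish-Chandra), and Flath's scalars
(`heckeOperatorAt_eq_satake_smul`) made pointwise (`heckeOperator_invQuot_eq_smul_of_heckeOperatorAt_eq_smul`,
`PairLFunctionPolesRepDataRealisation`):

* `exists_principalCongruenceLevel_rightTranslation_eq` (§1): an element of the space of automorphic
  forms on `GL_n(𝔸_K)` is right invariant under some `K(𝔫)`, `𝔫 ≠ 0`
  (`exists_isOpen_forall_rightTranslation_ofFinite_eq`, `exists_principalCongruenceLevel_subset`).
* `CuspidalAutomorphicRepGL.exists_cuspidalRepData_hasSatakeParamAt_of_isSatakeFamilyOf` (§2,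
  **main**): for a cuspidal `Π ⊂ L²_cusp(GL_n(𝔸_K) ⧸ A_G GL_n(K), μ)` with Satake family `α` off a
  finite `S` there is a cuspidal Borel–Jacquet datum `π = W / W'`, realised on `A_G`-invariant cusp
  forms, with `π.HasSatakeParamAt v (α v)` for almost every `v`. Proof: some `φ₀ = invQuot f₀ ≠ 0`,
  `[f₀] ∈ Π`, lies in `V_Π ≤ 𝒜₀` (`AutomorphicRepsGL.formsOfL2_le_cuspFormsGL`) and is
  `A_G`-invariant, i.e. `φ₀` lies in the stable space `𝒜₀ ⊓ bddInvariant`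
  (`isStableSubmodule_cuspFormsGL_inf_bddInvariant`); `φ₀` is `K(𝔫₀)`-invariant (§1) and generates a
  datum `W / W'` with `φ₀ ∈ W ∖ W'` in which every Hecke eigen-system of `φ₀` at `v ∤ 𝔫₀` is a
  Satake parameter (`AutomorphicRepOfForm`); `[f₀] ∈ Π^{K(𝔫₀)}`
  (`toLp_mem_fixedVectors_of_rightTranslation_invQuot_eq`), on which the unramified Hecke operators
  `T_{v,i}`, `v ∉ S`, `v ∤ 𝔫₀`, act by the Satake scalars `q_v^{i(n-i)/2} e_i(α v)`
  (`heckeOperatorAt_eq_satake_smul`: Flath 1979, Thm. 3), and this `L²` eigen-equation is the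
  pointwise eigen-equation `T_{v,i} φ₀ = q_v^{i(n-i)/2} e_i(α v) φ₀` (continuous representatives are
  unique, an automorphic measure charging open sets).
* `CuspidalAutomorphicRepGL.exists_cuspidalRepData_hasSatakeParamAt` (§2): the same in the shape
  consumed by the lifting files — for almost every `v`, *every* `L²` Satake parameter `β` of `Π` at
  `v` (any level `K(𝔫)`, `v ∤ 𝔫 ≠ 0`, any uniformizer) is a Satake parameter of `π` at `v`
  (uniqueness of `L²` Satake parameters, `HasSatakeParameterAt.eq_of_ofLocal_eq_smul` with
  `Flath1979_heckeOperatorAt_ofLocal_eq_smul_holds`).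

So an `L²` lifting theorem yields Borel–Jacquet data with the expected Satake parameters almost
everywhere with no appeal to `exists_cuspidalRepData_of_L2` / `hasSatakeParamAt_iff_L2`; the first
consumer is `AutomorphicInductionCharacterOfDescent` (Arthur–Clozel's Thm. 6.2 for `n = 1` from
Thm. 4.2 (e) alone).

## References

* A. Borel, H. Jacquet, *Automorphic forms and automorphic representations*, Proc. Sympos. Pure
  Math. 33 (Corvallis 1977), Part 1 (1979), §4.2 (a), §4.6. [BorelJacquet1979]
* D. Flath, *Decomposition of representations into tensor products*, Proc. Sympos. Pure Math. 33,
  Part 1 (1979), Thm. 3. [Flath1979]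
* R. P. Langlands, *On the notion of an automorphic representation*, Proc. Sympos. Pure Math. 33,
  Part 1 (1979), proof of Prop. 2. [LanglandsCorvallis1979Notion]
-/

noncomputable section

open scoped MatrixGroups Topology Classical
open NumberField IsDedekindDomain MeasureTheory Filter

namespace Literature.NumberTheory.Automorphic

open AdelicGroupData

variable {n : ℕ} {K : Type} [Field K] [NumberField K] {hcpt : isCompact_glFiniteIntegralLevel n K}
  {μ : Measure (gl n K).automorphicQuotient} [(gl n K).IsAutomorphicMeasure μ]

/-! ### 1. Levels of elements of the space of automorphic forms -/

omit [(gl n K).IsAutomorphicMeasure μ] in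
/-- **Every element of the space of automorphic forms on `GL_n(𝔸_K)` is right invariant under a
principal congruence subgroup `K(𝔫)`, `𝔫 ≠ 0`**: it is invariant under `{1} × U₀` for an open
subgroup `U₀ ≤ GL_n(𝔸_K^∞)` (`exists_isOpen_forall_rightTranslation_ofFinite_eq`), which contains the
finite part of some `K(𝔫)` (`exists_principalCongruenceLevel_subset`), and `K(𝔫) ≤ {1} × GL_n(𝒪̂_K)`
is `GLn.ofFinite` of its finite part. Borel–Jacquet 1979, §4.2 (a). [cite: BorelJacquet1979, §4.2 (a)] -/
theorem exists_principalCongruenceLevel_rightTranslation_eq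
    {φ : (gl n K).Adelic → ℂ} (hφ : φ ∈ automorphicForms (AutomorphyDatum.gl n K hcpt)) :
    ∃ 𝔫 : Ideal (𝓞 K), 𝔫 ≠ 0 ∧
      ∀ u ∈ principalCongruenceLevel n K 𝔫, rightTranslation (gl n K) u φ = φ := by
  obtain ⟨U₀, hU₀, hfix⟩ := exists_isOpen_forall_rightTranslation_ofFinite_eq hφ
  have hcont : Continuous (GLn.sndHom n K) := continuous_snd.generalLinearGroup_map
  have h1 : (U₀ : Set (GL (Fin n) (FiniteAdeleRing (𝓞 K) K))) ∈ 𝓝 (GLn.sndHom n K 1) := by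
    rw [map_one]
    exact hU₀.mem_nhds U₀.one_mem
  obtain ⟨𝔫, h𝔫, hsub⟩ := exists_principalCongruenceLevel_subset n K
    (hcont.continuousAt.preimage_mem_nhds h1)
  refine ⟨𝔫, h𝔫, fun u hu => ?_⟩
  have hu' : GLn.sndHom n K u ∈ U₀ := hsub hu
  rw [← GLn.ofFinite_sndHom_of_mem (principalCongruenceLevel_le n K 𝔫 hu)]
  exact hfix _ hu'

/-! ### 2. Cuspidal `Π ⊂ L²_cusp(GL_n)` ↦ a cuspidal Borel–Jacquet datum with the same Satake
parameters almost everywhere -/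

/-- **A cuspidal Borel–Jacquet datum with the Satake family of a cuspidal `Π ⊂ L²_cusp(GL_n)`.**
Let `Π` be an irreducible closed invariant subspace of `L²_cusp(GL_n(𝔸_K) ⧸ A_G GL_n(K), μ)` with
Satake family `α` off a finite set `S` (`IsSatakeFamilyOf`). Then there is a cuspidal automorphic
representation datum `π = W / W'` of `GL_n(𝔸_K)` (Borel–Jacquet 1979, 4.6), realised on
`A_G`-invariant cusp forms (`W ≤ 𝒜₀ ⊓ bddInvariant`), such that `α v` is a Satake parameter of `π`
at `v` for almost every finite place `v`. The datum is generated by a non-zero automorphic form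
`φ₀ = (g ↦ f₀ [g⁻¹])`, `[f₀] ∈ Π` (`AutomorphicRepsGL.formsOfL2_ne_bot_holds`;
`IsStableSubmodule.exists_automorphicRepData_hasSatakeParamAt_of_eigenvector` inside the stable
space of `A_G`-invariant cusp forms, `isStableSubmodule_cuspFormsGL_inf_bddInvariant`), and
`φ₀ ∈ W ∖ W'`, invariant under some `K(𝔫₀)`, is an exact Hecke eigenform at every `v ∉ S`,
`v ∤ 𝔫₀`, with the Satake eigenvalues `q_v^{i(n-i)/2} e_i(α v)` of `Π` on `Π^{K(𝔫₀)}` (Flath 1979,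
Thm. 3: `heckeOperatorAt_eq_satake_smul`; the `L²` identity is a pointwise one,
`heckeOperator_invQuot_eq_smul_of_heckeOperatorAt_eq_smul`). This is the part of Borel–Jacquet 4.6
("`L²_cusp ↦` cuspidal automorphic representations with the same local components") that existence
statements about cuspidal representations with prescribed unramified data consume; it avoids
Harish-Chandra's irreducibility of `V_Π`. [cite: BorelJacquet1979, 4.6] [cite: Flath1979, Thm. 3] -/
theorem CuspidalAutomorphicRepGL.exists_cuspidalRepData_hasSatakeParamAt_of_isSatakeFamilyOf
    (P : CuspidalAutomorphicRepGL n K μ) (hcpt : isCompact_glFiniteIntegralLevel n K)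
    {S : Set (HeightOneSpectrum (𝓞 K))} (hS : S.Finite) {α : SatakeFamily K}
    (hα : IsSatakeFamilyOf P S α) :
    ∃ π : CuspidalAutomorphicRepData n K hcpt,
      π.1.W ≤ cuspFormsGL n K hcpt ⊓ (gl n K).bddInvariant ∧
        ∀ᶠ v : HeightOneSpectrum (𝓞 K) in cofinite, π.1.HasSatakeParamAt v (α v) := by
  classical
  -- Step 1: a non-zero automorphic form `φ₀ = invQuot f₀` in `V_Π`, `[f₀] ∈ Π`
  have hne : formsOfL2 hcpt μ P.1 ≠ ⊥ := AutomorphicRepsGL.formsOfL2_ne_bot_holds hcpt μ P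
  obtain ⟨φ₀, hφ₀V, hφ₀0⟩ := (Submodule.ne_bot_iff _).1 hne
  obtain ⟨f₀, hf₀, hf₀P, hφf, hφ₀c⟩ := exists_toLp_mem_of_mem_formsOfL2_gl hφ₀V
  subst hφf
  -- Step 2: `φ₀` is an `A_G`-invariant cusp form, i.e. lies in the stable space `𝒜₀ ⊓ bddInvariant`
  have hφ₀cusp : invQuot (gl n K) f₀ ∈ cuspFormsGL n K hcpt :=
    AutomorphicRepsGL.formsOfL2_le_cuspFormsGL P.le_cuspidalSubspace hφ₀V
  have hφ₀A : ∀ z ∈ (gl n K).center', ∀ g,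
      invQuot (gl n K) f₀ (z * g) = invQuot (gl n K) f₀ g := fun z hz g =>
    invQuot_mul_left (gl n K) f₀ ((gl n K).center'_le_quotientSubgroup hz) g
  have hV : IsStableSubmodule (AutomorphyDatum.gl n K hcpt)
      (cuspFormsGL n K hcpt ⊓ (gl n K).bddInvariant) :=
    isStableSubmodule_cuspFormsGL_inf_bddInvariant
  have hφ₀V' : invQuot (gl n K) f₀ ∈ cuspFormsGL n K hcpt ⊓ (gl n K).bddInvariant :=
    mem_cuspFormsGL_inf_bddInvariant_iff.2 ⟨hφ₀cusp, hφ₀A⟩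
  -- Step 3: a level `K(𝔫₀)` of `φ₀`; `[f₀]` is a `K(𝔫₀)`-fixed vector of `Π`
  obtain ⟨𝔫₀, h𝔫₀, hfix⟩ := exists_principalCongruenceLevel_rightTranslation_eq
    (cuspFormsGL_le_automorphicForms n K hcpt hφ₀cusp)
  have hf₀P' : hf₀.toLp f₀ ∈ P.1.toSubmodule := hf₀P
  have hFfix : (⟨hf₀.toLp f₀, hf₀P'⟩ : P.1.toSubmodule) ∈
      P.1.fixedVectors (principalCongruenceLevel n K 𝔫₀) :=
    toLp_mem_fixedVectors_of_rightTranslation_invQuot_eq hf₀ hf₀P' hfix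
  have hf₀c : Continuous f₀ := continuous_of_continuous_invQuot hφ₀c
  -- Step 4: the datum `W / W'` generated by `φ₀`, `φ₀ ∈ W ∖ W'`, carrying every Hecke
  -- eigen-system of `φ₀` at `v ∤ 𝔫₀` as a Satake parameter
  obtain ⟨π, hφ₀W, hφ₀W', hπV, hsat⟩ :=
    hV.exists_automorphicRepData_hasSatakeParamAt_of_eigenvector hφ₀V' hφ₀0 h𝔫₀ hfix
  refine ⟨⟨π, hπV.trans inf_le_left⟩, hπV, ?_⟩
  -- Step 5: at almost every `v` (`v ∉ S`, `v ∤ 𝔫₀`), `φ₀` is a Hecke eigenform with the Satake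
  -- eigenvalues of `Π`
  have c1 : ∀ᶠ v : HeightOneSpectrum (𝓞 K) in cofinite, v ∉ S := hS.compl_mem_cofinite
  have c2 : ∀ᶠ v : HeightOneSpectrum (𝓞 K) in cofinite, ¬ v.asIdeal ∣ 𝔫₀ :=
    (Ideal.finite_factors h𝔫₀).compl_mem_cofinite
  filter_upwards [c1, c2] with v hvS hv𝔫₀
  obtain ⟨ϖ, hϖ, hT⟩ := heckeOperatorAt_eq_satake_smul P hα h𝔫₀ hvS hv𝔫₀ hFfix
  exact hsat v hv𝔫₀ ϖ (α v) hϖ (hα.card_eq hvS) fun i hi =>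
    heckeOperator_invQuot_eq_smul_of_heckeOperatorAt_eq_smul
      (finite_orbit_heckeDiagAt h𝔫₀ hv𝔫₀ hϖ i) hf₀ hf₀P' hf₀c hfix (hT i hi)

/-- **Realising a cuspidal `Π ⊂ L²_cusp(GL_n)` by a cuspidal Borel–Jacquet datum, at the level of
Satake parameters almost everywhere** (the shape consumed by the `L²`-model lifting theorems of the
tree). For every irreducible closed invariant `Π ≤ L²_cusp(GL_n(𝔸_K) ⧸ A_G GL_n(K), μ)` there is a
cuspidal automorphic representation datum `π = W / W'` of `GL_n(𝔸_K)`, realised on `A_G`-invariant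
cusp forms, such that for almost every finite place `v`: whenever `β` is a Satake parameter of `Π`
at `v` in the `L²` sense (`HasSatakeParameterAt Π K(𝔫) v ϖ β` for some level `K(𝔫)`, `v ∤ 𝔫 ≠ 0`,
and some uniformizer `ϖ`), `β` is a Satake parameter of `π` at `v` (`HasSatakeParamAt`). From
`exists_cuspidalRepData_hasSatakeParamAt_of_isSatakeFamilyOf` with a Satake family of `Π` off its
finitely many ramified places (`exists_isSatakeFamilyOf_holds`, Flath 1979, Thm. 3) and the
independence of `L²` Satake parameters of the level and the uniformizer
(`HasSatakeParameterAt.eq_of_ofLocal_eq_smul`, `Flath1979_heckeOperatorAt_ofLocal_eq_smul_holds`).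
Borel–Jacquet 1979, 4.6. [cite: BorelJacquet1979, 4.6] [cite: Flath1979, Thm. 3] -/
theorem CuspidalAutomorphicRepGL.exists_cuspidalRepData_hasSatakeParamAt
    (P : CuspidalAutomorphicRepGL n K μ) (hcpt : isCompact_glFiniteIntegralLevel n K) :
    ∃ π : CuspidalAutomorphicRepData n K hcpt,
      π.1.W ≤ cuspFormsGL n K hcpt ⊓ (gl n K).bddInvariant ∧
        ∀ᶠ v : HeightOneSpectrum (𝓞 K) in cofinite,
          ∀ (𝔫 : Ideal (𝓞 K)) (ϖ : (v.adicCompletion K)ˣ) (β : Multiset ℂ), 𝔫 ≠ 0 →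
            ¬ v.asIdeal ∣ 𝔫 → HasSatakeParameterAt P.1 (principalCongruenceLevel n K 𝔫) v ϖ β →
              π.1.HasSatakeParamAt v β := by
  obtain ⟨S, α, -, hα⟩ := exists_isSatakeFamilyOf_holds (n := n) (K := K) (μ := μ) P
  obtain ⟨π, hπ, hsat⟩ :=
    P.exists_cuspidalRepData_hasSatakeParamAt_of_isSatakeFamilyOf hcpt S.finite_toSet hα
  refine ⟨π, hπ, ?_⟩
  have c1 : ∀ᶠ v : HeightOneSpectrum (𝓞 K) in cofinite, v ∉ (S : Set (HeightOneSpectrum (𝓞 K))) :=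
    S.finite_toSet.compl_mem_cofinite
  filter_upwards [hsat, c1] with v hv hvS 𝔫 ϖ β h𝔫 hv𝔫 hβ
  obtain ⟨𝔫', h𝔫', hv𝔫', ϖ', hϖ'⟩ := hα v hvS
  have h := HasSatakeParameterAt.eq_of_ofLocal_eq_smul
    Flath1979_heckeOperatorAt_ofLocal_eq_smul_holds P h𝔫' h𝔫 hv𝔫' hv𝔫 hϖ' hβ
  rwa [← h]

end Literature.NumberTheory.Automorphic

end
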